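/-
Planner work file (lens «negation» at crux level) for the crux `KrwChromaticSteering.StrongComposition`
(C1, stmt-PneNP-18538), route `route-PneNP-KrwChromaticSteering`.  Seat pnp-ideate-p5 (g16), 2026-08-28.
Sorry-free.  Published with `ledger crux write stmt-PneNP-18538 LensNegationP5g16.lean`.
FRONTIER (formula-depth / KRW rung); nothing here bears on P vs NP.
-/
import Mathlib
import Summits.PneNP.PneNP.Cruxes.StrongComposition.Disproof
import Literature.Computability.Complexity.KWDepthHardFunctions

/-!
# Negation lens on `StrongComposition` (C1): the shape of any counterexample

Lens «negation»: try to BUILD a counterexample to C1 and type the obstructions.  Since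
`WeakKRW → C1` (`Disproof.strongComposition_of_weakKRW`) a counterexample to C1 is a counterexample to
the weak KRW conjecture (Meir 2023, Conj. 2) restricted to the strong game: a family of non-constant
outer functions `f` such that for EVERY inner `g` some strong protocol for `KW_f ⊛ KW_g` has depth
`< D(f) + n − ω(log(mn))`.  No such family is in print.  This file records, kernel-checked, what such a
family must look like — four constraints, each closing one template that was tried by hand
(the hand census is in `Ideas/negation-gap-casher.md`, § Dead lines).

* §0 `GoodFor` (the per-instance conclusion of C1) and `¬ C1` unfolded (`not_strongComposition_iff`).
* §1 INNER LOWER BOUND `C(KW_f ⊛ KW_g) ≥ C(KW_g)` for non-constant `f` (`exists_solves_inner`: plant the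
  `KW_g` instance in the row of a sensitive coordinate of `f`, freeze the other rows).  With the tree's
  `solves_comap_liftRows` (`≥ C(KW_f)`): savings of any protocol are `≤ min(D(f), D(g)) + O(1)` below
  `D(f) + D(g)`.
* §2 BOTH GAMES MUST BE DEEP: C1 holds outright on every instance with `n ≤ c·(⌊log₂(mn)⌋+1)`
  (`exists_goodFor_of_inner_short`) and on every instance whose outer game has a protocol of depth
  `≤ c·(⌊log₂(mn)⌋+1)` (`exists_goodFor_of_outer_shallow`, via the counting-hard `g` of
  `DepthHardFunctionsExist_holds`); hence `C1 ↔ C1 restricted to {n and D(f) both > c·(⌊log₂(mn)⌋+1)}`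
  (`strongComposition_iff_deep`).  A counterexample family has `min(D(f), n) = ω(log(mn))`; in
  particular `f` is non-explicit by today's lower bounds (`D(f) = ω(log m)` once `n ≤ poly(m)`).
* §3 NO `g`-OBLIVIOUS SCHEMA: if ONE tree solves `KW_f ⊛ KW_g` for every `g` and `2m ≤ 2ⁿ`, then `f` is
  decided by a single coordinate (`exists_coord_of_uniform`, `solves_leaf_of_uniform`: `D(f) = 0`).  So
  the trees of a counterexample family depend on `g` — against the counting-hard `g` of §2, on which
  nothing explicit is known.
* §4 SIZE–DEPTH DICHOTOMY: `StrongCompositionSize` (outer benchmark `log₂ L(f)`, Meir's Thm 3.1 shape at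
  `γ = 1`) is implied by C1 (`size_of_depth`), and `StrongCompositionSize ∧ AdditiveBalancing → C1`
  (`depth_of_size_of_balancing`), where `AdditiveBalancing := D(f) ≤ log₂ L(f) + O(log m)` uniformly.
  Hence a counterexample to C1 that is NOT one to the size form certifies `¬ AdditiveBalancing`
  (`gap_family_of_size_of_not_depth`): an additive size–depth gap `D(f) − log₂ L(f) = ω(log m)` — an open
  phenomenon (balancing is known only multiplicatively, `D ≤ 1.73 log₂ L`, Jukna BFC §6.1; additive
  balancing is known for bounded alternation depth, Lozhkin 1981, ibid.) — AND a strong protocol cashing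
  that gap against every `g`, which no composed-form protocol can do (`Disproof.exists_solvesStrong_depth_eq`
  is tight for composed protocols: cashing needs entangled protocols, i.e. `¬`KRW-type savings anyway).

* §5 THE UNIVERSAL-OUTER DOOR (refuter-facing): a protocol family saving `ω(log(mn))` below `m + n`
  on the outer-universal composition `U_m ⋄ KW_g` for EVERY `g` refutes `WeakKRW = C1 ∧ C2`
  (`not_weakKRW_of_univOuterSavings`, `not_cruxes_of_univOuterSavings`); on the strong variant
  `U_m ⊛ KW_g` it refutes C1 alone (`not_strongComposition_of_univOuterStrongSavings`).  This is the
  cheapest concrete falsifier of the pair: the printed lower bound there has an `O(√m)` slack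
  (Wu 2023 Thm 1.5, most `g`), the obvious upper bound is `m + n − log₂log₂ n + O(1)`.

All statements are elementary; the value is the typed census.  Nothing here is a Literature fact
(`StrongCompositionSize/Leaf`, `AdditiveBalancing`, `UnivOuter(Strong)Savings` are conjecture-shaped
`Prop`s used only as hypotheses).
-/

set_option linter.dupNamespace false
set_option autoImplicit false

namespace Summit.PneNP.PneNP.Cruxes.StrongComposition.LensNegation

open Literature.Computability.Complexity
open Summit.PneNP.PneNP.Theses.KrwChromaticSteering (StrongComposition)
open Summit.PneNP.PneNP.Cruxes.StrongComposition.Disproof (one_le_of_nonconst)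

/-! ## §0  The per-instance conclusion and `¬ C1` unfolded -/

/-- `GoodFor c m n f g`: every strong protocol for `KW_f ⊛ KW_g` yields a `KW_f` tree losing at most
`c·(⌊log₂(mn)⌋+1)` below `depth + n` — the conclusion of C1 at constant `c` on the instance `(m,n,f,g)`. -/
def GoodFor (c m n : ℕ) (f : (Fin m → Bool) → Bool) (g : (Fin n → Bool) → Bool) : Prop :=
  ∀ P : KWTree (Fin m × Fin n), P.SolvesStrong f g →
    ∃ Q : KWTree (Fin m), Q.Solves f ∧ Q.depth + n ≤ P.depth + c * (Nat.log 2 (m * n) + 1)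

/-- C1 is `∃ c ∀ m n ≥ 1 ∀ non-constant f ∃ g, GoodFor c m n f g` (definitional). -/
theorem strongComposition_iff_goodFor :
    StrongComposition ↔ ∃ c : ℕ, ∀ m n : ℕ, 1 ≤ n → ∀ f : (Fin m → Bool) → Bool,
      (∃ a b, f a ≠ f b) → ∃ g : (Fin n → Bool) → Bool, GoodFor c m n f g :=
  Iff.rfl

/-- `GoodFor` is monotone in the constant. -/
theorem GoodFor.mono {c c' m n : ℕ} {f : (Fin m → Bool) → Bool} {g : (Fin n → Bool) → Bool}
    (h : GoodFor c m n f g) (hc : c ≤ c') : GoodFor c' m n f g := by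
  intro P hP
  obtain ⟨Q, hQ, hd⟩ := h P hP
  have := Nat.mul_le_mul_right (Nat.log 2 (m * n) + 1) hc
  exact ⟨Q, hQ, by omega⟩

/-- **`¬ C1` unfolded** — what a counterexample IS: for every constant `c` an instance `(m, n, f)`,
`f` non-constant, such that for EVERY inner `g` some strong protocol beats every `KW_f` tree by more
than `c·(⌊log₂(mn)⌋+1) − n`.  (By `Disproof.weakKRW_iff_cruxes` this is in particular `¬ WeakKRW`.) -/
theorem not_strongComposition_iff :
    ¬ StrongComposition ↔ ∀ c : ℕ, ∃ m n : ℕ, 1 ≤ n ∧ ∃ f : (Fin m → Bool) → Bool,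
      (∃ a b, f a ≠ f b) ∧ ∀ g : (Fin n → Bool) → Bool, ∃ P : KWTree (Fin m × Fin n),
        P.SolvesStrong f g ∧ ∀ Q : KWTree (Fin m), Q.Solves f →
          P.depth + c * (Nat.log 2 (m * n) + 1) < Q.depth + n := by
  unfold StrongComposition
  push Not
  rfl

/-! ## §1a  A non-constant function has a sensitive edge
(local copy of `ShrinkageComposition.exists_sensitive`, whose module is not built on the farm snapshot;
same statement and proof, credited) -/

section Sens

open Finset Function

variable {m : ℕ}

/-- If no single-coordinate update changes `f`, then `f` is constant. [folklore] -/
theorem eq_of_forall_update {f : (Fin m → Bool) → Bool} (h : ∀ x i b, f (update x i b) = f x)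
    (x y : Fin m → Bool) : f x = f y := by
  classical
  generalize hk : (univ.filter fun i => x i ≠ y i).card = k
  induction k generalizing x with
  | zero =>
    have hxy : x = y := by
      funext i
      by_contra hne
      have hi : i ∈ univ.filter fun i => x i ≠ y i := by simpa using hne
      rw [Finset.card_eq_zero] at hk
      simp [hk] at hi
    rw [hxy]
  | succ k ih =>
    obtain ⟨i, hi⟩ : (univ.filter fun i => x i ≠ y i).Nonempty := by
      rw [← Finset.card_pos, hk]; exact Nat.succ_pos k
    have hne : x i ≠ y i := by simpa using hi
    rw [← h x i (y i)]
    apply ih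
    have hset : (univ.filter fun j => update x i (y i) j ≠ y j) =
        (univ.filter fun j => x j ≠ y j).erase i := by
      ext j
      by_cases hji : j = i
      · subst hji; simp
      · simp [hji]
    rw [hset, Finset.card_erase_of_mem hi, hk]
    rfl

/-- **A sensitive edge**: a non-constant `f` has an input `x` and a coordinate `i` with
`f (x with xᵢ = 1) ≠ f (x with xᵢ = 0)`. [folklore] -/
theorem exists_sensitive {f : (Fin m → Bool) → Bool} (hf : ∃ a b, f a ≠ f b) :
    ∃ (x : Fin m → Bool) (i : Fin m), f (update x i true) ≠ f (update x i false) := by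
  by_contra hall
  simp only [not_exists, ne_eq, not_not] at hall
  obtain ⟨a, b, hab⟩ := hf
  refine hab (eq_of_forall_update (fun x i c => ?_) a b)
  have hx : f (update x i (x i)) = f x := by rw [update_eq_self]
  cases c <;> cases hxi : x i <;> rw [hxi] at hx
  · exact hx
  · rw [← hall x i]; exact hx
  · rw [hall x i]; exact hx
  · exact hx

end Sens

/-! ## §1  The inner lower bound `C(KW_f ⊛ KW_g) ≥ C(KW_g)` -/

/-- Plant the string `s` as row `i₀`; every other row `i` is the fixed string `u` (if `x i = 1`) or
`v` (if `x i = 0`). -/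
def plantRow {m n : ℕ} (x : Fin m → Bool) (i₀ : Fin m) (u v s : Fin n → Bool) :
    Fin m × Fin n → Bool :=
  fun p => if p.1 = i₀ then s p.2 else if x p.1 = true then u p.2 else v p.2

/-- The row labels of the planted matrix: `x` with coordinate `i₀` replaced by `g s`. -/
theorem rowLabels_plantRow {m n : ℕ} {g : (Fin n → Bool) → Bool} {u v : Fin n → Bool}
    (hu : g u = true) (hv : g v = false) (x : Fin m → Bool) (i₀ : Fin m) (s : Fin n → Bool) :
    rowLabels g (plantRow x i₀ u v s) = Function.update x i₀ (g s) := by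
  funext i
  rw [rowLabels_apply, Function.update_apply]
  by_cases hi : i = i₀
  · subst hi
    have hrow : row (plantRow x i u v s) i = s := by
      funext j; simp [row, plantRow]
    rw [hrow, if_pos rfl]
  · rw [if_neg hi]
    cases hx : x i
    · have hrow : row (plantRow x i₀ u v s) i = v := by
        funext j; simp [row, plantRow, hi, hx]
      rw [hrow, hv]
    · have hrow : row (plantRow x i₀ u v s) i = u := by
        funext j; simp [row, plantRow, hi, hx]
      rw [hrow, hu]

/-- **`C(KW_f ⊛ KW_g) ≥ C(KW_g)` for non-constant `f`** (any `g`): a strong protocol, fed the matrices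
with the `KW_g` instance planted in the row `i₀` of a sensitive edge `(x^{i₀←1}, x^{i₀←0})` of `f` and
the other rows frozen to fixed preimages, must answer in row `i₀` (all other rows coincide), and its
column is a `KW_g` answer; roles are swapped when `f (x^{i₀←1}) = 0`.  Same depth (`depth_comap`).
[folklore; cf. Meir2023 §1 (the obvious protocol is optimal on each factor)] -/
theorem exists_solves_inner {m n : ℕ} {f : (Fin m → Bool) → Bool} (hf : ∃ a b, f a ≠ f b)
    {g : (Fin n → Bool) → Bool} {P : KWTree (Fin m × Fin n)} (hP : P.SolvesStrong f g) :
    ∃ R : KWTree (Fin n), R.Solves g ∧ R.depth = P.depth := by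
  classical
  by_cases hg : (∃ u, g u = true) ∧ (∃ v, g v = false)
  swap
  · -- `g` constant: the `KW_g` game is vacuous
    refine ⟨P.comap (fun _ _ => false) (fun _ _ => false) Prod.snd, fun z w hz hw => ?_, by simp⟩
    exact absurd ⟨⟨z, hz⟩, ⟨w, hw⟩⟩ hg
  obtain ⟨⟨u, hu⟩, ⟨v, hv⟩⟩ := hg
  obtain ⟨x, i₀, hx⟩ := exists_sensitive hf
  have key : ∀ s t : Fin n → Bool, blockComp f g (plantRow x i₀ u v s) = true →
      blockComp f g (plantRow x i₀ u v t) = false →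
      s (P.run (plantRow x i₀ u v s) (plantRow x i₀ u v t)).2 ≠
        t (P.run (plantRow x i₀ u v s) (plantRow x i₀ u v t)).2 := by
    intro s t hs ht
    have h1 := (hP _ _ hs ht).1
    set p := P.run (plantRow x i₀ u v s) (plantRow x i₀ u v t)
    by_cases hpi : p.1 = i₀
    · have e1 : plantRow x i₀ u v s p = s p.2 := by simp [plantRow, hpi]
      have e2 : plantRow x i₀ u v t p = t p.2 := by simp [plantRow, hpi]
      rwa [e1, e2] at h1
    · exact absurd (show plantRow x i₀ u v s p = plantRow x i₀ u v t p by simp [plantRow, hpi]) h1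
  cases hft : f (Function.update x i₀ true) with
  | true =>
    have hff : f (Function.update x i₀ false) = false := by
      cases h : f (Function.update x i₀ false)
      · rfl
      · exact absurd (hft.trans h.symm) hx
    refine ⟨P.comap (plantRow x i₀ u v) (plantRow x i₀ u v) Prod.snd, fun z w hz hw => ?_, by simp⟩
    rw [KWTree.run_comap]
    apply key
    · rw [blockComp_apply, rowLabels_plantRow hu hv, hz]; exact hft
    · rw [blockComp_apply, rowLabels_plantRow hu hv, hw]; exact hff
  | false =>
    have hff : f (Function.update x i₀ false) = true := by
      cases h : f (Function.update x i₀ false)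
      · exact absurd (hft.trans h.symm) hx
      · rfl
    refine ⟨(P.comap (plantRow x i₀ u v) (plantRow x i₀ u v) Prod.snd).swap,
      fun z w hz hw => ?_, by simp⟩
    rw [KWTree.run_swap, KWTree.run_comap]
    exact (key w z (by rw [blockComp_apply, rowLabels_plantRow hu hv, hw]; exact hff)
      (by rw [blockComp_apply, rowLabels_plantRow hu hv, hz]; exact hft)).symm

/-- Packaging of §1 with the tree's `solves_comap_liftRows`: every strong protocol for a pair of
non-constant functions is at least as deep as BOTH factor games. -/
theorem factors_le_strong {m n : ℕ} {f : (Fin m → Bool) → Bool} (hf : ∃ a b, f a ≠ f b)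
    {g : (Fin n → Bool) → Bool} (hg : ∃ u v, g u = true ∧ g v = false)
    {P : KWTree (Fin m × Fin n)} (hP : P.SolvesStrong f g) :
    (∃ Q : KWTree (Fin m), Q.Solves f ∧ Q.depth = P.depth) ∧
      (∃ R : KWTree (Fin n), R.Solves g ∧ R.depth = P.depth) := by
  obtain ⟨u, v, hu, hv⟩ := hg
  exact ⟨⟨_, KWTree.solves_comap_liftRows hP hu hv, by simp⟩, exists_solves_inner hf hP⟩

/-! ## §2  Both games must be deep in any counterexample -/

/-- SHORT INNER GAME: if `n ≤ c·(⌊log₂(mn)⌋+1)` the instance is good for every non-constant `g`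
(`Q :=` the row read-out of `P` on blown-up columns, same depth). -/
theorem goodFor_of_inner_short {c m n : ℕ} {f : (Fin m → Bool) → Bool}
    {g : (Fin n → Bool) → Bool} (hg : ∃ u v, g u = true ∧ g v = false)
    (h : n ≤ c * (Nat.log 2 (m * n) + 1)) : GoodFor c m n f g := by
  intro P hP
  obtain ⟨u, v, hu, hv⟩ := hg
  refine ⟨_, KWTree.solves_comap_liftRows hP hu hv, ?_⟩
  rw [KWTree.depth_comap]
  omega

/-- Hence C1's conclusion holds at constant `c` on every instance with `n ≤ c·(⌊log₂(mn)⌋+1)`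
(take `g` the first-bit dictator). -/
theorem exists_goodFor_of_inner_short {c m n : ℕ} (hn : 1 ≤ n) (f : (Fin m → Bool) → Bool)
    (h : n ≤ c * (Nat.log 2 (m * n) + 1)) : ∃ g : (Fin n → Bool) → Bool, GoodFor c m n f g :=
  ⟨fun u => u ⟨0, hn⟩, goodFor_of_inner_short ⟨fun _ => true, fun _ => false, rfl, rfl⟩ h⟩

/-- SHALLOW OUTER GAME: if `KW_f` has a tree of depth `≤ c·(⌊log₂(mn)⌋+1)`, the instance is good at
constant `c + c₀` for the counting-hard `g` of `DepthHardFunctionsExist_holds` (`c₀` its constant):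
by §1 the strong protocol is as deep as `KW_g`, i.e. `≥ n − c₀(⌊log₂ n⌋+1)`. -/
theorem exists_goodFor_of_outer_shallow :
    ∃ c₀ : ℕ, ∀ c m n : ℕ, 1 ≤ n → ∀ f : (Fin m → Bool) → Bool, (∃ a b, f a ≠ f b) →
      (∃ Q₀ : KWTree (Fin m), Q₀.Solves f ∧ Q₀.depth ≤ c * (Nat.log 2 (m * n) + 1)) →
        ∃ g : (Fin n → Bool) → Bool, GoodFor (c + c₀) m n f g := by
  obtain ⟨c₀, hhard⟩ := DepthHardFunctionsExist_holds
  refine ⟨c₀, fun c m n hn f hf hQ₀ => ?_⟩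
  obtain ⟨Q₀, hQ₀, hQ₀d⟩ := hQ₀
  obtain ⟨g, hg⟩ := hhard n hn
  refine ⟨g, fun P hP => ⟨Q₀, hQ₀, ?_⟩⟩
  obtain ⟨R, hR, hRd⟩ := exists_solves_inner hf hP
  have h1 := hg R hR
  have hm : 1 ≤ m := one_le_of_nonconst hf
  have hlog : Nat.log 2 n ≤ Nat.log 2 (m * n) :=
    Nat.log_mono_right (Nat.le_mul_of_pos_left n hm)
  have h2 : c₀ * (Nat.log 2 n + 1) ≤ c₀ * (Nat.log 2 (m * n) + 1) :=
    Nat.mul_le_mul_left c₀ (by omega)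
  have hsplit : (c + c₀) * (Nat.log 2 (m * n) + 1)
      = c * (Nat.log 2 (m * n) + 1) + c₀ * (Nat.log 2 (m * n) + 1) := by ring
  rw [hRd] at h1
  omega

/-- C1 RESTRICTED TO THE DEEP REGIME: the conclusion is only demanded on instances where BOTH the
inner width `n` and the outer depth complexity `D(f)` exceed `c·(⌊log₂(mn)⌋+1)`. -/
def StrongCompositionDeep : Prop :=
  ∃ c : ℕ, ∀ m n : ℕ, 1 ≤ n → ∀ f : (Fin m → Bool) → Bool, (∃ a b, f a ≠ f b) →
    c * (Nat.log 2 (m * n) + 1) < n →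
    (∀ Q : KWTree (Fin m), Q.Solves f → c * (Nat.log 2 (m * n) + 1) < Q.depth) →
      ∃ g : (Fin n → Bool) → Bool, GoodFor c m n f g

/-- **`C1 ↔ C1` on the deep regime.**  NEGATION READING: a counterexample family to C1 necessarily
has `n > c(⌊log₂(mn)⌋+1)` and `D(f) > c(⌊log₂(mn)⌋+1)` for every `c` along the family — both games
`ω(log mn)`-deep; `m = O(1)`, `n = O(log m)` and explicit-`f`-with-`n ≤ poly(m)` families are excluded. -/
theorem strongComposition_iff_deep : StrongComposition ↔ StrongCompositionDeep := by
  constructor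
  · rintro ⟨c, h⟩
    exact ⟨c, fun m n hn f hf _ _ => h m n hn f hf⟩
  · rintro ⟨c, h⟩
    obtain ⟨c₀, hsh⟩ := exists_goodFor_of_outer_shallow
    refine ⟨c + c₀, fun m n hn f hf => ?_⟩
    by_cases h1 : n ≤ (c + c₀) * (Nat.log 2 (m * n) + 1)
    · exact exists_goodFor_of_inner_short hn f h1
    by_cases h2 : ∃ Q₀ : KWTree (Fin m), Q₀.Solves f ∧ Q₀.depth ≤ c * (Nat.log 2 (m * n) + 1)
    · exact hsh c m n hn f hf h2
    · push Not at h1 h2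
      have hmul := Nat.mul_le_mul_right (Nat.log 2 (m * n) + 1) (Nat.le_add_right c c₀)
      obtain ⟨g, hg⟩ := h m n hn f hf (by omega) (fun Q hQ => h2 Q hQ)
      exact ⟨g, hg.mono (Nat.le_add_right c c₀)⟩

/-! ## §3  No `g`-oblivious schema -/

/-- **A single tree solving `KW_f ⊛ KW_g` for EVERY `g` pins `f` to one coordinate.**  Feed it two
matrices whose `2m` rows are pairwise distinct strings (`2m ≤ 2ⁿ`); every labelling `a ∈ f⁻¹(1)`,
`b ∈ f⁻¹(0)` of the rows is then realised by some `g`, while the tree's answer `(i, j)` does not depend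
on `g`: so `a_i ≠ b_i` for ALL such `a, b`. -/
theorem exists_coord_of_uniform {m n : ℕ} {f : (Fin m → Bool) → Bool}
    {P : KWTree (Fin m × Fin n)} (hP : ∀ g, P.SolvesStrong f g) (hmn : 2 * m ≤ 2 ^ n) :
    ∃ p : Fin m × Fin n, ∀ a b : Fin m → Bool, f a = true → f b = false → a p.1 ≠ b p.1 := by
  classical
  have hcard : Fintype.card (Fin (2 * m)) ≤ Fintype.card (Fin n → Bool) := by simpa using hmn
  obtain ⟨e⟩ := Function.Embedding.nonempty_iff_card_le.2 hcard
  let X : Fin m × Fin n → Bool := fun q => e ⟨q.1, by have := q.1.isLt; omega⟩ q.2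
  let Y : Fin m × Fin n → Bool := fun q => e ⟨m + q.1, by have := q.1.isLt; omega⟩ q.2
  have rowX : ∀ i : Fin m, row X i = e ⟨i, by have := i.isLt; omega⟩ := fun i => rfl
  have rowY : ∀ i : Fin m, row Y i = e ⟨m + i, by have := i.isLt; omega⟩ := fun i => rfl
  have hXX : ∀ i i' : Fin m, row X i = row X i' → i = i' := by
    intro i i' h
    rw [rowX, rowX] at h
    have := congrArg Fin.val (e.injective h)
    exact Fin.ext (by simpa using this)
  have hYY : ∀ i i' : Fin m, row Y i = row Y i' → i = i' := by
    intro i i' h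
    rw [rowY, rowY] at h
    have := congrArg Fin.val (e.injective h)
    exact Fin.ext (by simpa using this)
  have hXY : ∀ i i' : Fin m, row X i ≠ row Y i' := by
    intro i i' h
    rw [rowX, rowY] at h
    have h2 := congrArg Fin.val (e.injective h)
    dsimp at h2
    have := i.isLt
    omega
  refine ⟨P.run X Y, fun a b ha hb => ?_⟩
  let g : (Fin n → Bool) → Bool := fun s =>
    if h : ∃ i : Fin m, row X i = s then a (Classical.choose h)
    else if h' : ∃ i : Fin m, row Y i = s then b (Classical.choose h') else false
  have hgX : rowLabels g X = a := by
    funext i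
    rw [rowLabels_apply]
    have h : ∃ i' : Fin m, row X i' = row X i := ⟨i, rfl⟩
    simp only [g, dif_pos h]
    rw [hXX _ _ (Classical.choose_spec h)]
  have hgY : rowLabels g Y = b := by
    funext i
    rw [rowLabels_apply]
    have h : ¬ ∃ i' : Fin m, row X i' = row Y i := fun ⟨i', hi'⟩ => hXY i' i hi'
    have h' : ∃ i' : Fin m, row Y i' = row Y i := ⟨i, rfl⟩
    simp only [g, dif_neg h, dif_pos h']
    rw [hYY _ _ (Classical.choose_spec h')]
  have key := (hP g X Y (by rw [blockComp_apply, hgX]; exact ha)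
    (by rw [blockComp_apply, hgY]; exact hb)).2
  rwa [hgX, hgY] at key

/-- Corollary: under a `g`-oblivious schema the outer game has depth `0` (a leaf solves `KW_f`).  So the
trees of any counterexample family to C1 (where `D(f) = ω(log mn)`, §2) genuinely depend on `g`. -/
theorem solves_leaf_of_uniform {m n : ℕ} {f : (Fin m → Bool) → Bool}
    {P : KWTree (Fin m × Fin n)} (hP : ∀ g, P.SolvesStrong f g) (hmn : 2 * m ≤ 2 ^ n) :
    ∃ i : Fin m, (KWTree.leaf i).Solves f := by
  obtain ⟨p, hp⟩ := exists_coord_of_uniform hP hmn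
  exact ⟨p.1, fun a b ha hb => by simpa using hp a b ha hb⟩

/-- Contrapositive: if every `KW_f` tree has positive depth (no single coordinate decides `f`) and
`2m ≤ 2ⁿ`, no single tree solves the strong game for all inner functions. -/
theorem no_uniform_schema {m n : ℕ} {f : (Fin m → Bool) → Bool}
    (hf : ∀ Q : KWTree (Fin m), Q.Solves f → 1 ≤ Q.depth) (hmn : 2 * m ≤ 2 ^ n) :
    ¬ ∃ P : KWTree (Fin m × Fin n), ∀ g, P.SolvesStrong f g := by
  rintro ⟨P, hP⟩
  obtain ⟨i, hi⟩ := solves_leaf_of_uniform hP hmn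
  have := hf _ hi
  simp at this

/-! ## §4  The size–depth dichotomy of counterexamples -/

/-- `⌊log₂ (leaf count)⌋ ≤ depth` for every protocol tree. -/
theorem log_leafCount_le_depth {ι : Type*} (Q : KWTree ι) : Nat.log 2 Q.leafCount ≤ Q.depth :=
  calc Nat.log 2 Q.leafCount ≤ Nat.log 2 (2 ^ Q.depth) :=
        Nat.log_mono_right Q.leafCount_le_two_pow_depth
    _ = Q.depth := Nat.log_pow one_lt_two _

/-- C1 IN SIZE FORM (outer benchmark `⌊log₂ L(Q)⌋` for some `KW_f` tree `Q` — the optimal one gives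
`log₂ L(f)`): the shape of Meir's Theorem 3.1 / the tree's `MeirStrongComposition` with `γ = 1`
(no `24m/25` loss). [cite: Meir2023, Thm 3.1 (shape); this `γ = 1` form is conjectural] -/
def StrongCompositionSize : Prop :=
  ∃ c : ℕ, ∀ m n : ℕ, 1 ≤ n → ∀ f : (Fin m → Bool) → Bool, (∃ a b, f a ≠ f b) →
    ∃ g : (Fin n → Bool) → Bool, ∀ P : KWTree (Fin m × Fin n), P.SolvesStrong f g →
      ∃ Q : KWTree (Fin m), Q.Solves f ∧
        Nat.log 2 Q.leafCount + n ≤ P.depth + c * (Nat.log 2 (m * n) + 1)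

/-- ADDITIVE BALANCING (an open statement of formula complexity, NOT a Literature fact): every `KW_f`
tree `Q` can be replaced by one of depth `≤ ⌊log₂ L(Q)⌋ + c·(⌊log₂ m⌋+1)`, i.e.
`D(f) ≤ log₂ L(f) + O(log m)` uniformly.  Known: `D(f) ≤ 1.73·log₂ L(f)` (Khrapchenko 1978) and
`D(f) ≤ d − 1 + ⌈log₂ S⌉` for unbounded-fan-in depth-`d` formulas with `S` leaves (Lozhkin 1981);
neither gives nor refutes this. [cite: JuknaBFC2012, §6.1 (Lemma 6.1 and the Lozhkin remark)] -/
def AdditiveBalancing : Prop :=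
  ∃ c : ℕ, ∀ m : ℕ, ∀ f : (Fin m → Bool) → Bool, ∀ Q : KWTree (Fin m), Q.Solves f →
    ∃ Q' : KWTree (Fin m), Q'.Solves f ∧ Q'.depth ≤ Nat.log 2 Q.leafCount + c * (Nat.log 2 m + 1)

/-- C1 (depth form) implies the size form, with the same constant. -/
theorem size_of_depth (h : StrongComposition) : StrongCompositionSize := by
  obtain ⟨c, h⟩ := h
  refine ⟨c, fun m n hn f hf => ?_⟩
  obtain ⟨g, hg⟩ := h m n hn f hf
  refine ⟨g, fun P hP => ?_⟩
  obtain ⟨Q, hQ, hd⟩ := hg P hP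
  have := log_leafCount_le_depth Q
  exact ⟨Q, hQ, by omega⟩

/-- The size form plus additive balancing gives back C1 (constants add). -/
theorem depth_of_size_of_balancing (hS : StrongCompositionSize) (hB : AdditiveBalancing) :
    StrongComposition := by
  obtain ⟨c₁, hS⟩ := hS
  obtain ⟨c₂, hB⟩ := hB
  refine ⟨c₁ + c₂, fun m n hn f hf => ?_⟩
  obtain ⟨g, hg⟩ := hS m n hn f hf
  refine ⟨g, fun P hP => ?_⟩
  obtain ⟨Q, hQ, hd⟩ := hg P hP
  obtain ⟨Q', hQ', hd'⟩ := hB m f Q hQ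
  have hlog : Nat.log 2 m ≤ Nat.log 2 (m * n) :=
    Nat.log_mono_right (Nat.le_mul_of_pos_right m hn)
  have h2 : c₂ * (Nat.log 2 m + 1) ≤ c₂ * (Nat.log 2 (m * n) + 1) :=
    Nat.mul_le_mul_left c₂ (by omega)
  have hsplit : (c₁ + c₂) * (Nat.log 2 (m * n) + 1)
      = c₁ * (Nat.log 2 (m * n) + 1) + c₂ * (Nat.log 2 (m * n) + 1) := by ring
  exact ⟨Q', hQ', by omega⟩

/-- **DICHOTOMY, negation reading.**  A counterexample to C1 that is not a counterexample to the size
form refutes additive balancing. -/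
theorem not_balancing_of_size_of_not_depth (hS : StrongCompositionSize) (hN : ¬ StrongComposition) :
    ¬ AdditiveBalancing :=
  fun hB => hN (depth_of_size_of_balancing hS hB)

/-- The same, unfolded: such a counterexample exhibits, for every `c`, a function `f` on `m` bits and
a `KW_f` tree `Q` such that EVERY `KW_f` tree is deeper than `⌊log₂ L(Q)⌋ + c(⌊log₂ m⌋+1)` — an
additive size–depth gap of order `ω(log m)` (a "gap family"), which a strong protocol moreover cashes
against every `g`. -/
theorem gap_family_of_size_of_not_depth (hS : StrongCompositionSize) (hN : ¬ StrongComposition) :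
    ∀ c : ℕ, ∃ m : ℕ, ∃ f : (Fin m → Bool) → Bool, ∃ Q : KWTree (Fin m), Q.Solves f ∧
      ∀ Q' : KWTree (Fin m), Q'.Solves f → Nat.log 2 Q.leafCount + c * (Nat.log 2 m + 1) < Q'.depth := by
  have h := not_balancing_of_size_of_not_depth hS hN
  unfold AdditiveBalancing at h
  push Not at h
  exact h

/-- Where C1 sits: `StrongCompositionSize ∧ AdditiveBalancing → C1 → StrongCompositionSize`. -/
theorem sandwich :
    (StrongCompositionSize ∧ AdditiveBalancing → StrongComposition) ∧
      (StrongComposition → StrongCompositionSize) :=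
  ⟨fun h => depth_of_size_of_balancing h.1 h.2, size_of_depth⟩

/-- C1 IN PURE SIZE FORM (both benchmarks are leaf counts: `log₂ L(Q) + n ≤ log₂ L(P) + cL` — the
shape of the "moreover" clause of GMWW17 Thm 1.6 / formula-size KRW `L(f ⋄ g) ≳ L(f)·2ⁿ`).  It implies
the size form and is INCOMPARABLE with C1; unlike the size form it iterates (through formula size).
[cite: GavinskyMeirWeinsteinWigderson2017, Thm 1.6 (shape, inner universal relation)] -/
def StrongCompositionLeaf : Prop :=
  ∃ c : ℕ, ∀ m n : ℕ, 1 ≤ n → ∀ f : (Fin m → Bool) → Bool, (∃ a b, f a ≠ f b) →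
    ∃ g : (Fin n → Bool) → Bool, ∀ P : KWTree (Fin m × Fin n), P.SolvesStrong f g →
      ∃ Q : KWTree (Fin m), Q.Solves f ∧
        Nat.log 2 Q.leafCount + n ≤ Nat.log 2 P.leafCount + c * (Nat.log 2 (m * n) + 1)

/-- The pure size form implies the size form (`⌊log₂ L(P)⌋ ≤ depth P`). -/
theorem size_of_leaf (h : StrongCompositionLeaf) : StrongCompositionSize := by
  obtain ⟨c, h⟩ := h
  refine ⟨c, fun m n hn f hf => ?_⟩
  obtain ⟨g, hg⟩ := h m n hn f hf
  refine ⟨g, fun P hP => ?_⟩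
  obtain ⟨Q, hQ, hd⟩ := hg P hP
  have := log_leafCount_le_depth P
  exact ⟨Q, hQ, by omega⟩

/-! ## §5  The universal-outer door: savings on `U_m ⋄ KW_g` would kill the cruxes

Refuter-facing.  The one place where the printed LOWER bound leaves an `ω(log mn)` window is the
outer-universal composition: `CC(U_m ⋄ KW_g) ≥ m + n − O(√m)` for most `g` when `m = ω(log² n)`,
`n = ω(√m)` (Wu 2023, arXiv:2310.07422, Thm 1.5; Mihajlin–Smal 2021: `1.5n − o(n)` at `m ≈ n`), against
the obvious upper bound `m + n − log₂ log₂ n + O(1)`.  A protocol family saving `ω(log(mn))` below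
`m + n` on `U_m ⋄ KW_g` for EVERY `g` refutes `WeakKRW = C1 ∧ C2` (take the outer `f` counting-hard);
the same on the strong variant `U_m ⊛ KW_g` refutes C1 alone.  Both proved below. -/

/-- `P` solves the OUTER-UNIVERSAL composition `U_m ⋄ KW_g` (standard): on every pair of matrices whose
label columns `g(X), g(Y)` differ it outputs an entry where the matrices differ (in any row).
[cite: Wu2023 (arXiv:2310.07422), §1 (the relation `U_m ⋄ KW_f`; `⊥` is allowed only when the labels
agree, so on label-distinct pairs a differing entry must be output); MihajlinSmal2021] -/
def SolvesUnivOuter {m n : ℕ} (P : KWTree (Fin m × Fin n)) (g : (Fin n → Bool) → Bool) : Prop :=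
  ∀ X Y : Fin m × Fin n → Bool, rowLabels g X ≠ rowLabels g Y → X (P.run X Y) ≠ Y (P.run X Y)

/-- The STRONG outer-universal composition `U_m ⊛ KW_g`: the entry must moreover lie in a row where
the labels differ. [cite: Meir2023, Def. 1 (strong composition), applied with the universal outer
relation] -/
def SolvesUnivOuterStrong {m n : ℕ} (P : KWTree (Fin m × Fin n)) (g : (Fin n → Bool) → Bool) :
    Prop :=
  ∀ X Y : Fin m × Fin n → Bool, rowLabels g X ≠ rowLabels g Y →
    X (P.run X Y) ≠ Y (P.run X Y) ∧ rowLabels g X (P.run X Y).1 ≠ rowLabels g Y (P.run X Y).1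

theorem SolvesUnivOuterStrong.univ {m n : ℕ} {P : KWTree (Fin m × Fin n)}
    {g : (Fin n → Bool) → Bool} (h : SolvesUnivOuterStrong P g) : SolvesUnivOuter P g :=
  fun X Y hXY => (h X Y hXY).1

/-- A `U_m ⋄ KW_g` protocol solves `KW_{f ⋄ g}` for every `f` (the labels differ since `f` separates
them). -/
theorem SolvesUnivOuter.solves {m n : ℕ} {P : KWTree (Fin m × Fin n)} {g : (Fin n → Bool) → Bool}
    (h : SolvesUnivOuter P g) (f : (Fin m → Bool) → Bool) : P.Solves (blockComp f g) := by
  intro X Y hX hY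
  refine h X Y fun hlab => ?_
  rw [blockComp_apply, hlab] at hX
  rw [blockComp_apply, hX] at hY
  simp at hY

/-- A `U_m ⊛ KW_g` protocol solves `KW_f ⊛ KW_g` for every `f`. -/
theorem SolvesUnivOuterStrong.solvesStrong {m n : ℕ} {P : KWTree (Fin m × Fin n)}
    {g : (Fin n → Bool) → Bool} (h : SolvesUnivOuterStrong P g) (f : (Fin m → Bool) → Bool) :
    P.SolvesStrong f g := by
  intro X Y hX hY
  refine h X Y fun hlab => ?_
  rw [blockComp_apply, hlab] at hX
  rw [blockComp_apply, hX] at hY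
  simp at hY

/-- `C(U_m ⋄ KW_g) ≥ C(KW_g)` (`m ≥ 1`): plant the `KW_g` instance in row `0`, all other rows the
all-`0` string on both sides; the labels differ exactly in row `0`, so the answer lies there. -/
theorem exists_solves_inner_univ {m n : ℕ} (hm : 1 ≤ m) {g : (Fin n → Bool) → Bool}
    {P : KWTree (Fin m × Fin n)} (hP : SolvesUnivOuter P g) :
    ∃ R : KWTree (Fin n), R.Solves g ∧ R.depth = P.depth := by
  classical
  let i₀ : Fin m := ⟨0, hm⟩
  let E : (Fin n → Bool) → (Fin m × Fin n → Bool) := fun s p => if p.1 = i₀ then s p.2 else false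
  refine ⟨P.comap E E Prod.snd, fun z w hz hw => ?_, by simp⟩
  rw [KWTree.run_comap]
  have hr : ∀ s : Fin n → Bool, row (E s) i₀ = s := fun s => by funext j; simp [row, E]
  have hlab : rowLabels g (E z) ≠ rowLabels g (E w) := by
    intro h
    have := congrFun h i₀
    rw [rowLabels_apply, rowLabels_apply, hr, hr, hz, hw] at this
    simp at this
  have h1 := hP _ _ hlab
  set p := P.run (E z) (E w)
  by_cases hpi : p.1 = i₀
  · have e1 : E z p = z p.2 := by simp [E, hpi]
    have e2 : E w p = w p.2 := by simp [E, hpi]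
    rwa [e1, e2] at h1
  · exact absurd (show E z p = E w p by simp [E, hpi]) h1

/-- SAVINGS ON `U_m ⋄ KW_g` (a refuter's target; OPEN in print inside the window
`ω(log mn) ≤ savings ≤ O(√m)` left by Wu 2023 Thm 1.5): for every `c`, blocks `(m, n)` such that for
EVERY inner `g` some `U_m ⋄ KW_g` protocol has `depth + c(⌊log₂(mn)⌋+1) < m + n`. -/
def UnivOuterSavings : Prop :=
  ∀ c : ℕ, ∃ m n : ℕ, 1 ≤ m ∧ 1 ≤ n ∧ ∀ g : (Fin n → Bool) → Bool,
    ∃ P : KWTree (Fin m × Fin n), SolvesUnivOuter P g ∧ P.depth + c * (Nat.log 2 (m * n) + 1) < m + n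

/-- The same savings on the strong variant `U_m ⊛ KW_g`. -/
def UnivOuterStrongSavings : Prop :=
  ∀ c : ℕ, ∃ m n : ℕ, 1 ≤ m ∧ 1 ≤ n ∧ ∀ g : (Fin n → Bool) → Bool,
    ∃ P : KWTree (Fin m × Fin n), SolvesUnivOuterStrong P g ∧
      P.depth + c * (Nat.log 2 (m * n) + 1) < m + n

/-- **Savings on `U_m ⋄ KW_g` for all `g` refute weak KRW** (outer `f :=` the counting-hard function on
`m` bits of `DepthHardFunctionsExist_holds`; if that `f` happens to be constant, `m = O(log m)` and the
savings contradict `C(U_m ⋄ KW_g) ≥ C(KW_g)` for the hard `g` instead). -/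
theorem not_weakKRW_of_univOuterSavings (hS : UnivOuterSavings) : ¬ Disproof.WeakKRW := by
  rintro ⟨c, hW⟩
  obtain ⟨c₀, hhard⟩ := DepthHardFunctionsExist_holds
  obtain ⟨m, n, hm, hn, hsav⟩ := hS (c + c₀ + c₀)
  obtain ⟨f, hf⟩ := hhard m hm
  have hlogm : Nat.log 2 m ≤ Nat.log 2 (m * n) := Nat.log_mono_right (Nat.le_mul_of_pos_right m hn)
  have hlogn : Nat.log 2 n ≤ Nat.log 2 (m * n) := Nat.log_mono_right (Nat.le_mul_of_pos_left n hm)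
  have hsplit : (c + c₀ + c₀) * (Nat.log 2 (m * n) + 1) = c * (Nat.log 2 (m * n) + 1)
      + c₀ * (Nat.log 2 (m * n) + 1) + c₀ * (Nat.log 2 (m * n) + 1) := by ring
  have hc₀m : c₀ * (Nat.log 2 m + 1) ≤ c₀ * (Nat.log 2 (m * n) + 1) := Nat.mul_le_mul_left c₀ (by omega)
  have hc₀n : c₀ * (Nat.log 2 n + 1) ≤ c₀ * (Nat.log 2 (m * n) + 1) := Nat.mul_le_mul_left c₀ (by omega)
  by_cases hfc : ∃ a b, f a ≠ f b
  · obtain ⟨g₀, hg₀⟩ := hW m n hn f hfc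
    obtain ⟨P, hP, hPd⟩ := hsav g₀
    obtain ⟨Q, hQ, hQd⟩ := hg₀ P (hP.solves f)
    have h1 := hf Q hQ
    omega
  · push Not at hfc
    have h1 := hf (KWTree.leaf ⟨0, hm⟩) (fun a b ha hb => by
      rw [hfc a b] at ha; rw [ha] at hb; simp at hb)
    simp only [KWTree.depth_leaf, zero_add] at h1
    obtain ⟨g, hg⟩ := hhard n hn
    obtain ⟨P, hP, hPd⟩ := hsav g
    obtain ⟨R, hR, hRd⟩ := exists_solves_inner_univ hm hP
    have h2 := hg R hR
    rw [hRd] at h2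
    omega

/-- Hence such savings refute the conjunction of the route's two cruxes. -/
theorem not_cruxes_of_univOuterSavings (hS : UnivOuterSavings) :
    ¬ (StrongComposition ∧ Summit.PneNP.PneNP.Theses.KrwChromaticSteering.StandardFromStrong) :=
  fun h => not_weakKRW_of_univOuterSavings hS (Disproof.weakKRW_of_cruxes h.1 h.2)

/-- **Savings on the strong variant `U_m ⊛ KW_g` for all `g` refute C1 alone.** -/
theorem not_strongComposition_of_univOuterStrongSavings (hS : UnivOuterStrongSavings) :
    ¬ StrongComposition := by
  rintro ⟨c, hC⟩
  obtain ⟨c₀, hhard⟩ := DepthHardFunctionsExist_holds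
  obtain ⟨m, n, hm, hn, hsav⟩ := hS (c + c₀ + c₀)
  obtain ⟨f, hf⟩ := hhard m hm
  have hlogm : Nat.log 2 m ≤ Nat.log 2 (m * n) := Nat.log_mono_right (Nat.le_mul_of_pos_right m hn)
  have hlogn : Nat.log 2 n ≤ Nat.log 2 (m * n) := Nat.log_mono_right (Nat.le_mul_of_pos_left n hm)
  have hsplit : (c + c₀ + c₀) * (Nat.log 2 (m * n) + 1) = c * (Nat.log 2 (m * n) + 1)
      + c₀ * (Nat.log 2 (m * n) + 1) + c₀ * (Nat.log 2 (m * n) + 1) := by ring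
  have hc₀m : c₀ * (Nat.log 2 m + 1) ≤ c₀ * (Nat.log 2 (m * n) + 1) := Nat.mul_le_mul_left c₀ (by omega)
  have hc₀n : c₀ * (Nat.log 2 n + 1) ≤ c₀ * (Nat.log 2 (m * n) + 1) := Nat.mul_le_mul_left c₀ (by omega)
  by_cases hfc : ∃ a b, f a ≠ f b
  · obtain ⟨g₀, hg₀⟩ := hC m n hn f hfc
    obtain ⟨P, hP, hPd⟩ := hsav g₀
    obtain ⟨Q, hQ, hQd⟩ := hg₀ P (hP.solvesStrong f)
    have h1 := hf Q hQ
    omega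
  · push Not at hfc
    have h1 := hf (KWTree.leaf ⟨0, hm⟩) (fun a b ha hb => by
      rw [hfc a b] at ha; rw [ha] at hb; simp at hb)
    simp only [KWTree.depth_leaf, zero_add] at h1
    obtain ⟨g, hg⟩ := hhard n hn
    obtain ⟨P, hP, hPd⟩ := hsav g
    obtain ⟨R, hR, hRd⟩ := exists_solves_inner_univ hm hP.univ
    have h2 := hg R hR
    rw [hRd] at h2
    omega

end Summit.PneNP.PneNP.Cruxes.StrongComposition.LensNegation
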